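import Summits.CriticalPhenomena.PercolationContinuityZ3.Theorems.PercNearOneGluingNoHeavyLowerTailSahiE3MajCertRegimesA
import Summits.CriticalPhenomena.PercolationContinuityZ3.Theorems.PercNearOneGluingNoHeavyLowerTailSahiE3MajCertRegimesB
import Mathlib.Data.Real.Basic
import Mathlib.Tactic.Linarith
import Mathlib.Tactic.Positivity
import Mathlib.Tactic.FieldSimp
import HarnessLib
import HarnessLib.Audit

/-!
# `NoHeavyLowerTail` (crux stmt-CriticalPhenomena-4575), Sahi programme P4 (Holley / monotone coupling):
# the maj-slot certificate on the pattern `2³` — VIII: the failing-atom dichotomy (k = 2 labelled; k = 1, 0 relabelled)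

Support file (cell `prim-l12`, seat P4, generation 9; `--supports stmt-CriticalPhenomena-4575`).  No named facts, no
sorries; standard axioms; pure real algebra.  The proofs are machine-found certificates: every item is closed by `linarith` from an
explicit nonnegative combination of the listed facts (an exact rational Positivstellensatz-type certificate found by linear
programming over products of the facts with nonnegative aggregate masses, verified in exact arithmetic before emission; generator
and certificates in HOME prim-l12-p4/code/gen9, memo FROM-prim-l12-p4-gen9-MAJ-SLOT-LEAN.md).

Setting (memo HOME prim-l12-p4/FROM-prim-l12-p4-gen8-PATTERN-CERTIFICATES.md §4b): the pattern `2³` of three join-primes with the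
majority slot `MAJ = {ij, ik, jk, ⊤}`; for a labelling `(i, j, k)` of the atoms the eight fibre masses are `nE, ni, nj, nk, nij,
nik, njk, nT` with total `Z` (kept as a symbol; `d = nE+ni+nj+nk`, `u = nij+nik+njk+nT`, NOT normalised); the hypotheses are
consequences of log-supermodularity of the pattern measure (`…SahiE3MajPatternFacts.facts_of_pattern`); the conclusions are the
validity / up-transport / pair inequalities for retained masses `rij, rik, rjk, rT` (homogeneous of degree three) consumed by
`…SahiE3MajPattern.certificate_of_ineqs`.  Regimes: A (top full, uniform rank-2 fill), A'(k) (top full, Hall(k) tight), B1 (top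
only), B2(k) (donors of k drained) — HOME memo §4b; the case analysis is `…SahiE3MajCore.exists_cert`.
-/

namespace Summit.CriticalPhenomena.PercolationContinuityZ3.Theorems.SahiE3MajCert

/-- **The failing-atom regimes combined**: if atom `k` is the one whose single-atom Hall inequality fails
        (regime-A side) or whose
regime-B Hall inequality fails, a certificate exists (regime A'(k) when `u·n_k ≤ (Z+d)σ_k`, else B2(k); on the B
        side always B2(k)).
[this work] -/
theorem cert_k (nE ni nj nk nij nik njk nT Z : ℝ)
    (h_nn_E : 0 ≤ nE) (h_nn_0 : 0 ≤ ni) (h_nn_1 : 0 ≤ nj) (h_nn_2 : 0 ≤ nk) (h_nn_01 : 0 ≤ nij) (h_nn_02 : 0 ≤ nik)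
    (h_nn_12 : 0 ≤ njk) (h_nn_T : 0 ≤ nT) (h_nn_Z : 0 ≤ Z) (h_sum : Z = nE + ni + nj + nk + nij + nik + njk + nT)
    (h_lsm_r2 : nik * njk ≤ nk * nT) (h_fkg_aa02 : (ni + nij + nik + nT) * (nk + nik + njk + nT) ≤ Z * (nik + nT))
    (h_fkg_aa12 : (nj + nij + njk + nT) * (nk + nik + njk + nT) ≤ Z * (njk + nT))
    (h_fkg_AA0 : (nij + nT) * (nik + nT) ≤ Z * nT) (h_fkg_AA1 : (nij + nT) * (njk + nT) ≤ Z * nT)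
    (h_fkg_AA2 : (nik + nT) * (njk + nT) ≤ Z * nT) (h_fkg_Aa01 : (nij + nT) * (nk + nik + njk + nT) ≤ Z * nT)
    (h_fkg_Aa02 : (nik + nT) * (nj + nij + njk + nT) ≤ Z * nT)
    (h_fkg_Aa12 : (njk + nT) * (ni + nij + nik + nT) ≤ Z * nT)
    (h_ad_2 : (nij + nik + njk + nT) * nk ≤ (nE + ni + nj + nk) * (nik + njk + nT))
    (hcase : ((nE + ni + nj + nk) * nT ≤ Z * (nij + nik + njk) ∧ ((nE + ni + nj + nk) - nk) * (nik + njk) < nk *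
            nij) ∨
      (Z * (nij + nik + njk) < (nE + ni + nj + nk) * nT ∧ (Z + (nE + ni + nj + nk)) * (nik + njk + nT) <
              (nij + nik + njk + nT) * (Z + nk))) :
    ∃ rij rik rjk rT : ℝ,
      0 ≤ rij ∧
      0 ≤ rik ∧
      0 ≤ rjk ∧
      0 ≤ rT ∧
      rij ≤ Z * (Z + (nE + ni + nj + nk)) * nij ∧
              rik ≤ Z * (Z + (nE + ni + nj + nk)) * nik ∧
      rjk ≤ Z * (Z + (nE + ni + nj + nk)) * njk ∧
              rT ≤ Z * (Z + (nE + ni + nj + nk)) * nT ∧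
      Z * (nij + nik + njk + nT) * ni ≤
              (Z * (Z + (nE + ni + nj + nk)) * nij - rij) + (Z * (Z + (nE + ni + nj + nk)) * nik - rik) +
              (Z * (Z + (nE + ni + nj + nk)) * nT - rT) ∧
      Z * (nij + nik + njk + nT) * nj ≤
              (Z * (Z + (nE + ni + nj + nk)) * nij - rij) + (Z * (Z + (nE + ni + nj + nk)) * njk - rjk) +
              (Z * (Z + (nE + ni + nj + nk)) * nT - rT) ∧
      Z * (nij + nik + njk + nT) * nk ≤
              (Z * (Z + (nE + ni + nj + nk)) * nik - rik) + (Z * (Z + (nE + ni + nj + nk)) * njk - rjk) +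
              (Z * (Z + (nE + ni + nj + nk)) * nT - rT) ∧
      rij + rik + rjk + rT = Z * Z *
              (nij + nik + njk + nT) ∧
      Z * Z * nT ≤ rT ∧
      Z * Z * (nij + nT) ≤ rij + rT ∧
      Z * Z *
              (nik + nT) ≤ rik + rT ∧
      Z * Z * (njk + nT) ≤ rjk + rT ∧
      Z * Z * (nij + nik + nT) ≤ rij +
              rik + rT ∧
      Z * Z * (nij + njk + nT) ≤ rij + rjk + rT ∧
      Z * Z * (nik + njk + nT) ≤ rik +
              rjk + rT ∧
      Z * ((nij + nT) * (nik + nT) + (nik + nT) * (nij + nT)) - (nij + nik + njk + nT) *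
              (nij + nT) * (nik + nT) ≤ rT ∧
      Z * ((nij + nT) * (njk + nT) + (njk + nT) * (nij + nT)) -
              (nij + nik + njk + nT) * (nij + nT) * (njk + nT) ≤ rT ∧
      Z *
              ((nik + nT) * (njk + nT) + (njk + nT) * (nik + nT)) - (nij + nik + njk + nT) * (nik + nT) *
              (njk + nT) ≤ rT ∧
      Z * ((nij + nT) * (nik + njk + nT) + (nk + nik + njk + nT) * (nij + nT)) -
              (nij + nik + njk + nT) * (nij + nT) * (nk + nik + njk + nT) ≤ rT ∧
      Z *
              ((nik + nT) * (nij + njk + nT) + (nj + nij + njk + nT) * (nik + nT)) - (nij + nik + njk + nT) *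
              (nik + nT) * (nj + nij + njk + nT) ≤ rT ∧
      Z *
              ((njk + nT) * (nij + nik + nT) + (ni + nij + nik + nT) * (njk + nT)) - (nij + nik + njk + nT) *
              (njk + nT) * (ni + nij + nik + nT) ≤ rT ∧
      Z *
              ((ni + nij + nik + nT) * (nij + nik + nT) + (ni + nij + nik + nT) * (nij + nik + nT)) -
              (nij + nik + njk + nT) * (ni + nij + nik + nT) * (ni + nij + nik + nT) ≤ rij + rik + rT ∧
      Z *
              ((nj + nij + njk + nT) * (nij + njk + nT) + (nj + nij + njk + nT) * (nij + njk + nT)) -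
              (nij + nik + njk + nT) * (nj + nij + njk + nT) * (nj + nij + njk + nT) ≤ rij + rjk + rT ∧
      Z *
              ((nk + nik + njk + nT) * (nik + njk + nT) + (nk + nik + njk + nT) * (nik + njk + nT)) -
              (nij + nik + njk + nT) * (nk + nik + njk + nT) * (nk + nik + njk + nT) ≤ rik + rjk + rT ∧
      Z *
              ((ni + nij + nik + nT) * (nij + njk + nT) + (nj + nij + njk + nT) * (nij + nik + nT)) -
              (nij + nik + njk + nT) * (ni + nij + nik + nT) * (nj + nij + njk + nT) ≤ rij + rT ∧
      Z *
              ((ni + nij + nik + nT) * (nik + njk + nT) + (nk + nik + njk + nT) * (nij + nik + nT)) -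
              (nij + nik + njk + nT) * (ni + nij + nik + nT) * (nk + nik + njk + nT) ≤ rik + rT ∧
      Z *
              ((nj + nij + njk + nT) * (nik + njk + nT) + (nk + nik + njk + nT) * (nij + njk + nT)) -
              (nij + nik + njk + nT) * (nj + nij + njk + nT) * (nk + nik + njk + nT) ≤ rjk + rT := by
  rcases hcase with ⟨hN2, hnA⟩ | ⟨hN2', hBk⟩
  · by_cases hlam : (nij + nik + njk + nT) * nk ≤ (Z + (nE + ni + nj + nk)) * (nik + njk)
    · have hsig : 0 < nik + njk := by
        by_contra hs
        have hs0 : nik + njk = 0 := le_antisymm (not_lt.1 hs) (by linarith [h_nn_02, h_nn_12])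
        rw [hs0, mul_zero] at hnA hlam
        have hle : nij ≤ (nij + nik + njk + nT) := by linarith [h_nn_02, h_nn_12, h_nn_T]
        nlinarith [mul_le_mul_of_nonneg_right hle h_nn_2]
      exact cert_Ap nE ni nj nk nij nik njk nT Z h_nn_E h_nn_0 h_nn_1 h_nn_2 h_nn_01 h_nn_02 h_nn_12 h_nn_T h_nn_Z
              h_sum h_lsm_r2 h_fkg_aa02 h_fkg_aa12 h_fkg_AA0 h_fkg_AA1 h_fkg_AA2 h_fkg_Aa01 h_fkg_Aa02 h_fkg_Aa12
              h_ad_2 hnA.le hN2 hlam hsig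
    · have hlam2 : (Z + (nE + ni + nj + nk)) * (nik + njk) ≤ (nij + nik + njk + nT) * nk := le_of_lt (not_le.1 hlam)
      have hh2 : 0 ≤ (nij + nik + njk + nT)*(Z + nk) - (Z + (nE + ni + nj + nk))*(nik + njk + nT) := by
        linarith [hN2, not_le.1 hlam]
      exact cert_B2 nE ni nj nk nij nik njk nT Z h_nn_E h_nn_0 h_nn_1 h_nn_2 h_nn_01 h_nn_02 h_nn_12 h_nn_T h_nn_Z
              h_sum h_fkg_aa02 h_fkg_aa12 h_fkg_Aa01 h_ad_2 hlam2 hh2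
  · have hlam2 : (Z + (nE + ni + nj + nk)) * (nik + njk) ≤ (nij + nik + njk + nT) * nk := by
      linarith [hN2', hBk]
    have hh2 : 0 ≤ (nij + nik + njk + nT)*(Z + nk) - (Z + (nE + ni + nj + nk))*(nik + njk + nT) := by
      linarith [hBk]
    exact cert_B2 nE ni nj nk nij nik njk nT Z h_nn_E h_nn_0 h_nn_1 h_nn_2 h_nn_01 h_nn_02 h_nn_12 h_nn_T h_nn_Z
            h_sum h_fkg_aa02 h_fkg_aa12 h_fkg_Aa01 h_ad_2 hlam2 hh2

/-- The failing-atom dichotomy for atom `1` (instance of `cert_k` with the atoms relabelled so that `1` is last; the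
conclusion is restated in the canonical order). [this work] -/
theorem cert_k1 (nE n0 n1 n2 n01 n02 n12 nT Z : ℝ)
    (h_nn_E : 0 ≤ nE) (h_nn_0 : 0 ≤ n0) (h_nn_1 : 0 ≤ n1) (h_nn_2 : 0 ≤ n2) (h_nn_01 : 0 ≤ n01) (h_nn_02 : 0 ≤ n02)
    (h_nn_12 : 0 ≤ n12) (h_nn_T : 0 ≤ nT) (h_nn_Z : 0 ≤ Z) (h_sum : Z = nE + n0 + n1 + n2 + n01 + n02 + n12 + nT)
    (h_lsm_r1 : n01 * n12 ≤ n1 * nT) (h_fkg_aa01 : (n0 + n01 + n02 + nT) * (n1 + n01 + n12 + nT) ≤ Z * (n01 + nT))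
    (h_fkg_aa12 : (n1 + n01 + n12 + nT) * (n2 + n02 + n12 + nT) ≤ Z * (n12 + nT))
    (h_fkg_AA0 : (n01 + nT) * (n02 + nT) ≤ Z * nT) (h_fkg_AA1 : (n01 + nT) * (n12 + nT) ≤ Z * nT)
    (h_fkg_AA2 : (n02 + nT) * (n12 + nT) ≤ Z * nT) (h_fkg_Aa01 : (n01 + nT) * (n2 + n02 + n12 + nT) ≤ Z * nT)
    (h_fkg_Aa02 : (n02 + nT) * (n1 + n01 + n12 + nT) ≤ Z * nT)
    (h_fkg_Aa12 : (n12 + nT) * (n0 + n01 + n02 + nT) ≤ Z * nT)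
    (h_ad_1 : (n01 + n02 + n12 + nT) * n1 ≤ (nE + n0 + n1 + n2) * (n01 + n12 + nT))
    (hcase : ((nE + n0 + n2 + n1) * nT ≤ Z * (n02 + n01 + n12) ∧ ((nE + n0 + n2 + n1) - n1) * (n01 + n12) < n1 *
            n02) ∨ (Z * (n02 + n01 + n12) < (nE + n0 + n2 + n1) * nT ∧ (Z + (nE + n0 + n2 + n1)) * (n01 + n12 + nT)
            < (n02 + n01 + n12 + nT) * (Z + n1))) :
    ∃ r01 r02 r12 rT : ℝ,
      0 ≤ r01 ∧
      0 ≤ r02 ∧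
      0 ≤ r12 ∧
      0 ≤ rT ∧
      r01 ≤ Z * (Z + (nE + n0 + n1 + n2)) * n01 ∧
              r02 ≤ Z * (Z + (nE + n0 + n1 + n2)) * n02 ∧
      r12 ≤ Z * (Z + (nE + n0 + n1 + n2)) * n12 ∧
              rT ≤ Z * (Z + (nE + n0 + n1 + n2)) * nT ∧
      Z * (n01 + n02 + n12 + nT) * n0 ≤
              (Z * (Z + (nE + n0 + n1 + n2)) * n01 - r01) + (Z * (Z + (nE + n0 + n1 + n2)) * n02 - r02) +
              (Z * (Z + (nE + n0 + n1 + n2)) * nT - rT) ∧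
      Z * (n01 + n02 + n12 + nT) * n1 ≤
              (Z * (Z + (nE + n0 + n1 + n2)) * n01 - r01) + (Z * (Z + (nE + n0 + n1 + n2)) * n12 - r12) +
              (Z * (Z + (nE + n0 + n1 + n2)) * nT - rT) ∧
      Z * (n01 + n02 + n12 + nT) * n2 ≤
              (Z * (Z + (nE + n0 + n1 + n2)) * n02 - r02) + (Z * (Z + (nE + n0 + n1 + n2)) * n12 - r12) +
              (Z * (Z + (nE + n0 + n1 + n2)) * nT - rT) ∧
      r01 + r02 + r12 + rT = Z * Z *
              (n01 + n02 + n12 + nT) ∧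
      Z * Z * nT ≤ rT ∧
      Z * Z * (n01 + nT) ≤ r01 + rT ∧
      Z * Z *
              (n02 + nT) ≤ r02 + rT ∧
      Z * Z * (n12 + nT) ≤ r12 + rT ∧
      Z * Z * (n01 + n02 + nT) ≤ r01 +
              r02 + rT ∧
      Z * Z * (n01 + n12 + nT) ≤ r01 + r12 + rT ∧
      Z * Z * (n02 + n12 + nT) ≤ r02 +
              r12 + rT ∧
      Z * ((n01 + nT) * (n02 + nT) + (n02 + nT) * (n01 + nT)) - (n01 + n02 + n12 + nT) *
              (n01 + nT) * (n02 + nT) ≤ rT ∧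
      Z * ((n01 + nT) * (n12 + nT) + (n12 + nT) * (n01 + nT)) -
              (n01 + n02 + n12 + nT) * (n01 + nT) * (n12 + nT) ≤ rT ∧
      Z *
              ((n02 + nT) * (n12 + nT) + (n12 + nT) * (n02 + nT)) - (n01 + n02 + n12 + nT) * (n02 + nT) *
              (n12 + nT) ≤ rT ∧
      Z * ((n01 + nT) * (n02 + n12 + nT) + (n2 + n02 + n12 + nT) * (n01 + nT)) -
              (n01 + n02 + n12 + nT) * (n01 + nT) * (n2 + n02 + n12 + nT) ≤ rT ∧
      Z *
              ((n02 + nT) * (n01 + n12 + nT) + (n1 + n01 + n12 + nT) * (n02 + nT)) - (n01 + n02 + n12 + nT) *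
              (n02 + nT) * (n1 + n01 + n12 + nT) ≤ rT ∧
      Z *
              ((n12 + nT) * (n01 + n02 + nT) + (n0 + n01 + n02 + nT) * (n12 + nT)) - (n01 + n02 + n12 + nT) *
              (n12 + nT) * (n0 + n01 + n02 + nT) ≤ rT ∧
      Z *
              ((n0 + n01 + n02 + nT) * (n01 + n02 + nT) + (n0 + n01 + n02 + nT) * (n01 + n02 + nT)) -
              (n01 + n02 + n12 + nT) * (n0 + n01 + n02 + nT) * (n0 + n01 + n02 + nT) ≤ r01 + r02 + rT ∧
      Z *
              ((n1 + n01 + n12 + nT) * (n01 + n12 + nT) + (n1 + n01 + n12 + nT) * (n01 + n12 + nT)) -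
              (n01 + n02 + n12 + nT) * (n1 + n01 + n12 + nT) * (n1 + n01 + n12 + nT) ≤ r01 + r12 + rT ∧
      Z *
              ((n2 + n02 + n12 + nT) * (n02 + n12 + nT) + (n2 + n02 + n12 + nT) * (n02 + n12 + nT)) -
              (n01 + n02 + n12 + nT) * (n2 + n02 + n12 + nT) * (n2 + n02 + n12 + nT) ≤ r02 + r12 + rT ∧
      Z *
              ((n0 + n01 + n02 + nT) * (n01 + n12 + nT) + (n1 + n01 + n12 + nT) * (n01 + n02 + nT)) -
              (n01 + n02 + n12 + nT) * (n0 + n01 + n02 + nT) * (n1 + n01 + n12 + nT) ≤ r01 + rT ∧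
      Z *
              ((n0 + n01 + n02 + nT) * (n02 + n12 + nT) + (n2 + n02 + n12 + nT) * (n01 + n02 + nT)) -
              (n01 + n02 + n12 + nT) * (n0 + n01 + n02 + nT) * (n2 + n02 + n12 + nT) ≤ r02 + rT ∧
      Z *
              ((n1 + n01 + n12 + nT) * (n02 + n12 + nT) + (n2 + n02 + n12 + nT) * (n01 + n12 + nT)) -
              (n01 + n02 + n12 + nT) * (n1 + n01 + n12 + nT) * (n2 + n02 + n12 + nT) ≤ r12 + rT := by
  have g_sum : Z = nE + n0 + n2 + n1 + n02 + n01 + n12 + nT := by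
    linarith [h_sum]
  have g_fkg_aa02 : (n0 + n02 + n01 + nT) * (n1 + n01 + n12 + nT) ≤ Z * (n01 + nT) := by
    linarith [h_fkg_aa01]
  have g_fkg_aa12 : (n2 + n02 + n12 + nT) * (n1 + n01 + n12 + nT) ≤ Z * (n12 + nT) := by
    linarith [h_fkg_aa12]
  have g_fkg_AA0 : (n02 + nT) * (n01 + nT) ≤ Z * nT := by
    linarith [h_fkg_AA0]
  have g_fkg_Aa12 : (n12 + nT) * (n0 + n02 + n01 + nT) ≤ Z * nT := by
    linarith [h_fkg_Aa12]
  have g_ad_2 : (n02 + n01 + n12 + nT) * n1 ≤ (nE + n0 + n2 + n1) * (n01 + n12 + nT) := by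
    linarith [h_ad_1]
  obtain ⟨rij, rik, rjk, rT', c⟩ := cert_k nE n0 n2 n1 n02 n01 n12 nT Z h_nn_E h_nn_0 h_nn_2 h_nn_1 h_nn_02 h_nn_01
          h_nn_12 h_nn_T h_nn_Z g_sum h_lsm_r1 g_fkg_aa02 g_fkg_aa12 g_fkg_AA0 h_fkg_AA2 h_fkg_AA1 h_fkg_Aa02
          h_fkg_Aa01 g_fkg_Aa12 g_ad_2 hcase
  obtain ⟨c1, c2, c3, c4, c5, c6, c7, c8, c9, c10, c11, c12, c13, c14, c15, c16, c17, c18, c19, c20, c21, c22, c23,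
          c24, c25, c26, c27, c28, c29, c30, c31⟩ := c
  exact ⟨rik, rij, rjk, rT', by linarith [c2], by linarith [c1], by linarith [c3], c4, by linarith [c6], by
          linarith [c5], by linarith [c7], by linarith [c8], by linarith [c9], by linarith [c11], by linarith
          [c10], by linarith [c12], c13, by linarith [c15], by linarith [c14], by linarith [c16], by linarith
          [c17], by linarith [c19], by linarith [c18], by linarith [c20], by linarith [c22], by linarith [c21], by
          linarith [c24], by linarith [c23], by linarith [c25], by linarith [c26], by linarith [c28], by linarith
          [c27], by linarith [c30], by linarith [c29], by linarith [c31]⟩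

/-- The failing-atom dichotomy for atom `0` (instance of `cert_k` with the atoms relabelled so that `0` is last; the
conclusion is restated in the canonical order). [this work] -/
theorem cert_k0 (nE n0 n1 n2 n01 n02 n12 nT Z : ℝ)
    (h_nn_E : 0 ≤ nE) (h_nn_0 : 0 ≤ n0) (h_nn_1 : 0 ≤ n1) (h_nn_2 : 0 ≤ n2) (h_nn_01 : 0 ≤ n01) (h_nn_02 : 0 ≤ n02)
    (h_nn_12 : 0 ≤ n12) (h_nn_T : 0 ≤ nT) (h_nn_Z : 0 ≤ Z) (h_sum : Z = nE + n0 + n1 + n2 + n01 + n02 + n12 + nT)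
    (h_lsm_r0 : n01 * n02 ≤ n0 * nT) (h_fkg_aa01 : (n0 + n01 + n02 + nT) * (n1 + n01 + n12 + nT) ≤ Z * (n01 + nT))
    (h_fkg_aa02 : (n0 + n01 + n02 + nT) * (n2 + n02 + n12 + nT) ≤ Z * (n02 + nT))
    (h_fkg_AA0 : (n01 + nT) * (n02 + nT) ≤ Z * nT) (h_fkg_AA1 : (n01 + nT) * (n12 + nT) ≤ Z * nT)
    (h_fkg_AA2 : (n02 + nT) * (n12 + nT) ≤ Z * nT) (h_fkg_Aa01 : (n01 + nT) * (n2 + n02 + n12 + nT) ≤ Z * nT)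
    (h_fkg_Aa02 : (n02 + nT) * (n1 + n01 + n12 + nT) ≤ Z * nT)
    (h_fkg_Aa12 : (n12 + nT) * (n0 + n01 + n02 + nT) ≤ Z * nT)
    (h_ad_0 : (n01 + n02 + n12 + nT) * n0 ≤ (nE + n0 + n1 + n2) * (n01 + n02 + nT))
    (hcase : ((nE + n1 + n2 + n0) * nT ≤ Z * (n12 + n01 + n02) ∧ ((nE + n1 + n2 + n0) - n0) * (n01 + n02) < n0 *
            n12) ∨ (Z * (n12 + n01 + n02) < (nE + n1 + n2 + n0) * nT ∧ (Z + (nE + n1 + n2 + n0)) * (n01 + n02 + nT)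
            < (n12 + n01 + n02 + nT) * (Z + n0))) :
    ∃ r01 r02 r12 rT : ℝ,
      0 ≤ r01 ∧
      0 ≤ r02 ∧
      0 ≤ r12 ∧
      0 ≤ rT ∧
      r01 ≤ Z * (Z + (nE + n0 + n1 + n2)) * n01 ∧
              r02 ≤ Z * (Z + (nE + n0 + n1 + n2)) * n02 ∧
      r12 ≤ Z * (Z + (nE + n0 + n1 + n2)) * n12 ∧
              rT ≤ Z * (Z + (nE + n0 + n1 + n2)) * nT ∧
      Z * (n01 + n02 + n12 + nT) * n0 ≤
              (Z * (Z + (nE + n0 + n1 + n2)) * n01 - r01) + (Z * (Z + (nE + n0 + n1 + n2)) * n02 - r02) +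
              (Z * (Z + (nE + n0 + n1 + n2)) * nT - rT) ∧
      Z * (n01 + n02 + n12 + nT) * n1 ≤
              (Z * (Z + (nE + n0 + n1 + n2)) * n01 - r01) + (Z * (Z + (nE + n0 + n1 + n2)) * n12 - r12) +
              (Z * (Z + (nE + n0 + n1 + n2)) * nT - rT) ∧
      Z * (n01 + n02 + n12 + nT) * n2 ≤
              (Z * (Z + (nE + n0 + n1 + n2)) * n02 - r02) + (Z * (Z + (nE + n0 + n1 + n2)) * n12 - r12) +
              (Z * (Z + (nE + n0 + n1 + n2)) * nT - rT) ∧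
      r01 + r02 + r12 + rT = Z * Z *
              (n01 + n02 + n12 + nT) ∧
      Z * Z * nT ≤ rT ∧
      Z * Z * (n01 + nT) ≤ r01 + rT ∧
      Z * Z *
              (n02 + nT) ≤ r02 + rT ∧
      Z * Z * (n12 + nT) ≤ r12 + rT ∧
      Z * Z * (n01 + n02 + nT) ≤ r01 +
              r02 + rT ∧
      Z * Z * (n01 + n12 + nT) ≤ r01 + r12 + rT ∧
      Z * Z * (n02 + n12 + nT) ≤ r02 +
              r12 + rT ∧
      Z * ((n01 + nT) * (n02 + nT) + (n02 + nT) * (n01 + nT)) - (n01 + n02 + n12 + nT) *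
              (n01 + nT) * (n02 + nT) ≤ rT ∧
      Z * ((n01 + nT) * (n12 + nT) + (n12 + nT) * (n01 + nT)) -
              (n01 + n02 + n12 + nT) * (n01 + nT) * (n12 + nT) ≤ rT ∧
      Z *
              ((n02 + nT) * (n12 + nT) + (n12 + nT) * (n02 + nT)) - (n01 + n02 + n12 + nT) * (n02 + nT) *
              (n12 + nT) ≤ rT ∧
      Z * ((n01 + nT) * (n02 + n12 + nT) + (n2 + n02 + n12 + nT) * (n01 + nT)) -
              (n01 + n02 + n12 + nT) * (n01 + nT) * (n2 + n02 + n12 + nT) ≤ rT ∧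
      Z *
              ((n02 + nT) * (n01 + n12 + nT) + (n1 + n01 + n12 + nT) * (n02 + nT)) - (n01 + n02 + n12 + nT) *
              (n02 + nT) * (n1 + n01 + n12 + nT) ≤ rT ∧
      Z *
              ((n12 + nT) * (n01 + n02 + nT) + (n0 + n01 + n02 + nT) * (n12 + nT)) - (n01 + n02 + n12 + nT) *
              (n12 + nT) * (n0 + n01 + n02 + nT) ≤ rT ∧
      Z *
              ((n0 + n01 + n02 + nT) * (n01 + n02 + nT) + (n0 + n01 + n02 + nT) * (n01 + n02 + nT)) -
              (n01 + n02 + n12 + nT) * (n0 + n01 + n02 + nT) * (n0 + n01 + n02 + nT) ≤ r01 + r02 + rT ∧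
      Z *
              ((n1 + n01 + n12 + nT) * (n01 + n12 + nT) + (n1 + n01 + n12 + nT) * (n01 + n12 + nT)) -
              (n01 + n02 + n12 + nT) * (n1 + n01 + n12 + nT) * (n1 + n01 + n12 + nT) ≤ r01 + r12 + rT ∧
      Z *
              ((n2 + n02 + n12 + nT) * (n02 + n12 + nT) + (n2 + n02 + n12 + nT) * (n02 + n12 + nT)) -
              (n01 + n02 + n12 + nT) * (n2 + n02 + n12 + nT) * (n2 + n02 + n12 + nT) ≤ r02 + r12 + rT ∧
      Z *
              ((n0 + n01 + n02 + nT) * (n01 + n12 + nT) + (n1 + n01 + n12 + nT) * (n01 + n02 + nT)) -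
              (n01 + n02 + n12 + nT) * (n0 + n01 + n02 + nT) * (n1 + n01 + n12 + nT) ≤ r01 + rT ∧
      Z *
              ((n0 + n01 + n02 + nT) * (n02 + n12 + nT) + (n2 + n02 + n12 + nT) * (n01 + n02 + nT)) -
              (n01 + n02 + n12 + nT) * (n0 + n01 + n02 + nT) * (n2 + n02 + n12 + nT) ≤ r02 + rT ∧
      Z *
              ((n1 + n01 + n12 + nT) * (n02 + n12 + nT) + (n2 + n02 + n12 + nT) * (n01 + n12 + nT)) -
              (n01 + n02 + n12 + nT) * (n1 + n01 + n12 + nT) * (n2 + n02 + n12 + nT) ≤ r12 + rT := by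
  have g_sum : Z = nE + n1 + n2 + n0 + n12 + n01 + n02 + nT := by
    linarith [h_sum]
  have g_fkg_aa02 : (n1 + n12 + n01 + nT) * (n0 + n01 + n02 + nT) ≤ Z * (n01 + nT) := by
    linarith [h_fkg_aa01]
  have g_fkg_aa12 : (n2 + n12 + n02 + nT) * (n0 + n01 + n02 + nT) ≤ Z * (n02 + nT) := by
    linarith [h_fkg_aa02]
  have g_fkg_AA0 : (n12 + nT) * (n01 + nT) ≤ Z * nT := by
    linarith [h_fkg_AA1]
  have g_fkg_AA1 : (n12 + nT) * (n02 + nT) ≤ Z * nT := by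
    linarith [h_fkg_AA2]
  have g_fkg_Aa02 : (n01 + nT) * (n2 + n12 + n02 + nT) ≤ Z * nT := by
    linarith [h_fkg_Aa01]
  have g_fkg_Aa12 : (n02 + nT) * (n1 + n12 + n01 + nT) ≤ Z * nT := by
    linarith [h_fkg_Aa02]
  have g_ad_2 : (n12 + n01 + n02 + nT) * n0 ≤ (nE + n1 + n2 + n0) * (n01 + n02 + nT) := by
    linarith [h_ad_0]
  obtain ⟨rij, rik, rjk, rT', c⟩ := cert_k nE n1 n2 n0 n12 n01 n02 nT Z h_nn_E h_nn_1 h_nn_2 h_nn_0 h_nn_12 h_nn_01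
          h_nn_02 h_nn_T h_nn_Z g_sum h_lsm_r0 g_fkg_aa02 g_fkg_aa12 g_fkg_AA0 g_fkg_AA1 h_fkg_AA0 h_fkg_Aa12
          g_fkg_Aa02 g_fkg_Aa12 g_ad_2 hcase
  obtain ⟨c1, c2, c3, c4, c5, c6, c7, c8, c9, c10, c11, c12, c13, c14, c15, c16, c17, c18, c19, c20, c21, c22, c23,
          c24, c25, c26, c27, c28, c29, c30, c31⟩ := c
  exact ⟨rik, rjk, rij, rT', by linarith [c2], by linarith [c3], by linarith [c1], c4, by linarith [c6], by
          linarith [c7], by linarith [c5], by linarith [c8], by linarith [c11], by linarith [c9], by linarith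
          [c10], by linarith [c12], c13, by linarith [c15], by linarith [c16], by linarith [c14], by linarith
          [c19], by linarith [c17], by linarith [c18], by linarith [c22], by linarith [c20], by linarith [c21], by
          linarith [c24], by linarith [c25], by linarith [c23], by linarith [c28], by linarith [c26], by linarith
          [c27], by linarith [c30], by linarith [c31], by linarith [c29]⟩

end Summit.CriticalPhenomena.PercolationContinuityZ3.Theorems.SahiE3MajCert
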